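import Summits.ValiantsHypothesis.ValiantsHypothesis.Theses.LacunarySymmetroid
import Summits.ValiantsHypothesis.ValiantsHypothesis.Theorems.LacunarySymmetroidMatrixDescartesCensusDefs

/-!
# `MatrixDescartes` census — DOOR A: the route item `LacunarySymmetroid.DoorA34` IS the cell's typed target `DoorA34`

HONEST FRAMING.  Object-search cell `pub-symmetroid`, crux `Theses.LacunarySymmetroid.MatrixDescartes`
(stmt-ValiantsHypothesis-18050).  Under HUMAN RULING D-0059 (ledger homes for every rung) the cell's two standalone
finite-format theorem TARGETS were filed as SUPPORT statement items on route `LacunarySymmetroid`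
(`Theses.LacunarySymmetroid.DoorA26`, item stmt-ValiantsHypothesis-19979; `Theses.LacunarySymmetroid.DoorA34`, item stmt-ValiantsHypothesis-19980), with the
signatures `PosRootLawAt 2 6 19` / `PosRootLawAt 3 4 18` UNFOLDED in the route file's vocabulary.  This file records,
by `Iff.rfl`, that those item statements are literally the typed targets `LacunarySymmetroidMatrixDescartes.DoorA26 /
DoorA34` of the Defs module (and hence everything proved about the latter — `…CensusDoorA`, the BOX20 replays, the
uniform rays — is about the items).  Both statements are OPEN and asserted nowhere; nothing here bears on
`MatrixDescartes` or on `VP ≠ VNP`.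

[folklore] Bookkeeping; no citation exists or is needed.
-/

-- `Summit.ValiantsHypothesis.ValiantsHypothesis.…` repeats a component by the D-0017 layout
-- (single-conjunct summit), which the `dupNamespace` linter flags; the name is mandated.
set_option linter.dupNamespace false

namespace Summit.ValiantsHypothesis.ValiantsHypothesis.Theorems.LacunarySymmetroidMatrixDescartes.Census

open Summit.ValiantsHypothesis.ValiantsHypothesis.Theorems.MatrixDescartes.Negative (PosRootLawAt)

/-- The route item `LacunarySymmetroid.DoorA34` (stmt-ValiantsHypothesis-19980) is, by `Iff.rfl`, the cell's typed target `DoorA34`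
(`= PosRootLawAt 3 4 18`, …CensusDefs). [folklore] -/
theorem doorA34_item_iff :
    Summit.ValiantsHypothesis.ValiantsHypothesis.Theses.LacunarySymmetroid.DoorA34 ↔ DoorA34 := Iff.rfl

/-- Item form of `DoorA34` as a format row: `LacunarySymmetroid.DoorA34 ↔ PosRootLawAt 3 4 18`. [folklore] -/
theorem doorA34_item_iff_posRootLawAt :
    Summit.ValiantsHypothesis.ValiantsHypothesis.Theses.LacunarySymmetroid.DoorA34 ↔ PosRootLawAt 3 4 18 := Iff.rfl

/-- Transport: a proof of the cell's target proves the item. [folklore] -/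
theorem doorA34_item_of (h : DoorA34) : Summit.ValiantsHypothesis.ValiantsHypothesis.Theses.LacunarySymmetroid.DoorA34 := h

/-- Transport: a refutation of the cell's target refutes the item. [folklore] -/
theorem not_doorA34_item_of (h : ¬ DoorA34) : ¬ Summit.ValiantsHypothesis.ValiantsHypothesis.Theses.LacunarySymmetroid.DoorA34 := h

end Summit.ValiantsHypothesis.ValiantsHypothesis.Theorems.LacunarySymmetroidMatrixDescartes.Census
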